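import Summits.PneNP.PneNP.Theorems.ExpanderLinearGeneratorsGridRoutingOverlayTransfer
import Summits.PneNP.PneNP.Theorems.ExpanderLinearGeneratorsGridRoutingOverlayExpansion
import Summits.PneNP.PneNP.Theorems.ExpanderLinearGeneratorsGridRoutingLowerBound

/-!
# PneNP / ExpanderLinearGenerators — the crux `LinearGeneratorDepthFregeHard` HOLDS on an explicit
family: expanding `60`-sparse unsolvable systems with exponential bounded-depth Frege lower bounds

Route `PneNP/ExpanderLinearGenerators`, crux stmt-PneNP-11443 (`LinearGeneratorDepthFregeHard`,
Krajíček's Problem 19.4.5 in universal-expander form: every `ℓ`-sparse unsolvable system over `𝔽₂`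
whose row supports form an `(n^(1-δ), 3ℓ/4)`-boundary expander forces depth-`d` `textbookFrege`
refutations of size `2^(n^ε)`). The crux is open. This file proves that its BODY holds, for
`ℓ = 60`, every depth `d` and every `δ > 0`, on an explicit infinite family of instances — so the
crux is not only non-vacuous (`…DepthSevenCompleteness`, `…Instances`) but TRUE where we can test
it, unconditionally:

* the instances: the grid routing system of the bijective pigeonhole principle on `k + 2` pigeons
  (`…GridRoutingSystem`) overlaid with a `56`-regular locally sparse lift of `K₅₇` on `57` copies of
  its rows (`…GridRoutingOverlay`, `Literature.Combinatorics.SimpleGraph.exists_sparse_lift`):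
  supports `≤ 60`, `(r, 45)`-boundary expanding for `r` linear in the number of variables
  (`…OverlayExpansion`), unsolvable (odd charge);
* the lower bound: a depth-`d` refutation of an instance restricts (edge variables `↦ ⊥`,
  `…OverlayTransfer`) to a depth-`(d+16)` refutation of the grid routing system, which by the
  Urquhart–Fu / Ben-Sasson reduction and the `k`-evaluation lower bound for the onto pigeonhole
  principle has size `2^{k^{Ω(1)}}` (`…GridRoutingLowerBound`);
* `linearGeneratorDepthFregeHard_on_gridFamily` — **for every `d` and `δ > 0` there are `ε > 0`
  and `K₀` such that for every `k ≥ K₀` there is an instance `(n, m, E)` with `k ≤ n`, satisfying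
  every hypothesis of the crux for `ℓ = 60` at scale `n^(1-δ)`, all of whose depth-`d`
  `textbookFrege` refutations have `proofSize ≥ 2^(n^ε)`.**

References: A. Urquhart, X. Fu, NDJFL 37 (1996); E. Ben-Sasson, Comput. Complexity 11 (2002);
J. Krajíček, *Proof complexity* (CUP 2019), Problem 19.4.5, §13.3; N. Galesi et al., APAL 174
(2023), Lemma 10.
-/

namespace Summit.PneNP.PneNP.Theorems.GridRouting

set_option linter.dupNamespace false -- `Summit.PneNP.PneNP.…`: summit = sub-problem (D-0017)

open Filter Finset Literature.Computability.Complexity.PropForm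
open Literature.Computability.Complexity (PropForm)
open Literature.Computability.MetaComplexity Literature.Computability.MetaComplexity.TextbookFrege
open Literature.ModelTheory.FiniteModelTheory.ConnerydGhannanePang (IsSparse)
open Literature.Combinatorics.SimpleGraph

/-! ### The size of the transfer is polynomial -/

/-- `tautLines` is sub-multiplicative in the size budget. [folklore] -/
theorem tautLines_le_mul {N S₀ : ℕ} (h : 1 ≤ S₀) : tautLines N S₀ ≤ S₀ * tautLines N 1 := by
  unfold tautLines
  have : S₀ * (100 * (N + 8) ^ 2) + 50 * (2 * N + 3) ^ 2 + 2 ≤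
      S₀ * (1 * (100 * (N + 8) ^ 2) + 50 * (2 * N + 3) ^ 2 + 2) := by nlinarith
  calc 2 ^ N * (S₀ * (100 * (N + 8) ^ 2) + 50 * (2 * N + 3) ^ 2 + 2)
      ≤ 2 ^ N * (S₀ * (1 * (100 * (N + 8) ^ 2) + 50 * (2 * N + 3) ^ 2 + 2)) :=
        Nat.mul_le_mul_left _ this
    _ = S₀ * (2 ^ N * (1 * (100 * (N + 8) ^ 2) + 50 * (2 * N + 3) ^ 2 + 2)) := by ring

/-- **The transfer is polynomial**: its size bound is at most `transferConst · (Z + 3)³` for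
`Z = S + 224 m`. [folklore] -/
theorem transferBound_le (S m : ℕ) :
    transferLines S (S + 224 * m) 16 4 * (40 * ((16 + 3) * (S + 224 * m + 3) + 4) + 300) ≤
      transferConst * (S + 224 * m + 3) ^ 3 := by
  generalize hZ : S + 224 * m = Z
  have hSZ : S ≤ Z := by omega
  unfold transferLines transferClauseLines transferConst
  have ht : tautLines (4 + 16 + 1) ((16 + 1) * (Z + 2)) ≤
      ((16 + 1) * (Z + 2)) * tautLines (4 + 16 + 1) 1 := tautLines_le_mul (by omega)
  generalize tautLines (4 + 16 + 1) 1 = T₁ at ht ⊢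
  generalize tautLines (4 + 16 + 1) ((16 + 1) * (Z + 2)) = X at ht ⊢
  have hP : X ≤ 17 * ((Z + 3) * T₁) := by
    have : (16 + 1) * (Z + 2) * T₁ ≤ 17 * ((Z + 3) * T₁) := by
      rw [Nat.mul_assoc]; exact Nat.mul_le_mul_left _ (Nat.mul_le_mul_right _ (by omega))
    exact ht.trans this
  generalize hPdef : (Z + 3) * T₁ = P at hP
  simp only [Nat.reduceAdd, Nat.reduceMul, Nat.reducePow]
  -- NB: `omega` must not see the large-coefficient facts below (grey-shadow blow-up): `linarith`.
  have h2 : 40 * (19 * (Z + 3) + 4) + 300 ≤ 1000 * (Z + 3) := by omega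
  have h1 : X + 20000 + 16 * (130 * (Z + 3) + 20000 + 8) + 51 ≤
      17 * P + 125000 * (Z + 3) := by linarith
  have h3 : S + Z * (X + 20000 + 16 * (130 * (Z + 3) + 20000 + 8) + 51) +
      2300 ≤ (Z + 3) * (17 * P + 126000 * (Z + 3)) := by
    have h4 := Nat.mul_le_mul_left Z h1
    have h5 : Z * (17 * P + 125000 * (Z + 3)) + (S + 2300) ≤
        (Z + 3) * (17 * P + 126000 * (Z + 3)) := by nlinarith
    linarith
  calc _ ≤ (Z + 3) * (17 * P + 126000 * (Z + 3)) * (1000 * (Z + 3)) := Nat.mul_le_mul h3 h2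
    _ = 1000 * (17 * P + 126000 * (Z + 3)) * (Z + 3) ^ 2 := by ring
    _ = 1000 * (17 * ((Z + 3) * T₁) + 126000 * (Z + 3)) * (Z + 3) ^ 2 := by rw [hPdef]
    _ = 1000 * (17 * T₁ + 126000) * (Z + 3) ^ 3 := by ring

/-! ### Arithmetic of the family -/

/-- `nRows k ≤ (k + 3)²` and `k ≤ nVars k ≤ 2 nRows k`. [folklore] -/
theorem nRows_bounds (k : ℕ) : nRows k ≤ (k + 3) ^ 2 ∧ k ≤ nVars k ∧ nVars k ≤ 2 * nRows k ∧
    1 ≤ nRows k ∧ (k + 1) ^ 2 ≤ nRows k := by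
  simp only [nRows, nVars]
  refine ⟨by nlinarith, by nlinarith, by nlinarith, by nlinarith, by nlinarith⟩

/-- Eventually in `n`: `227 n ≤ 2^{n^ε}` and `8 C ≤ 2^{n^ε}`. [folklore] -/
theorem eventually_linear_le_two_rpow (Cst : ℕ) {ε : ℝ} (hε : 0 < ε) :
    ∀ᶠ n : ℕ in atTop, (227 * (n : ℝ) ≤ (2 : ℝ) ^ ((n : ℝ) ^ ε)) ∧
      ((8 * Cst : ℝ) ≤ (2 : ℝ) ^ ((n : ℝ) ^ ε)) := by
  have h2 := Literature.Computability.Complexity.eventually_pow_lt_two_rpow_rpow 2 hε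
  have hge : ∀ᶠ n : ℕ in atTop, 227 + 8 * Cst ≤ n := eventually_ge_atTop _
  filter_upwards [h2, hge] with n hn hge'
  have hn1 : (227 + 8 * Cst : ℝ) ≤ n := by exact_mod_cast hge'
  have hn0 : (0 : ℝ) ≤ n := Nat.cast_nonneg n
  have hsq : (n : ℝ) ^ 2 < (2 : ℝ) ^ ((n : ℝ) ^ ε) := by simpa using hn
  constructor
  · nlinarith
  · nlinarith

/-- Eventually in `k`: `4 · (1600 (k+3)²)^{ε₀/8} ≤ k^{ε₀}`. [folklore] -/
theorem eventually_scale_exponent {ε₀ : ℝ} (hε₀ : 0 < ε₀) :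
    ∀ᶠ k : ℕ in atTop, 4 * ((1600 : ℝ) * ((k : ℝ) + 3) ^ 2) ^ (ε₀ / 8) ≤ (k : ℝ) ^ ε₀ := by
  set A : ℝ := 4 * (1600 : ℝ) ^ (ε₀ / 8) * (2 : ℝ) ^ (ε₀ / 4) with hA
  have hApos : 0 < A := by positivity
  have hT : Tendsto (fun k : ℕ => (k : ℝ) ^ (3 * ε₀ / 4)) atTop atTop :=
    (tendsto_rpow_atTop (by positivity)).comp tendsto_natCast_atTop_atTop
  filter_upwards [hT.eventually_ge_atTop A, eventually_ge_atTop 3] with k hk hk3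
  have hk0 : (0 : ℝ) < k := by exact_mod_cast (show 0 < k by omega)
  have hk3' : (3 : ℝ) ≤ k := by exact_mod_cast hk3
  -- `(1600 (k+3)²)^{ε₀/8} = 1600^{ε₀/8} (k+3)^{ε₀/4} ≤ 1600^{ε₀/8} (2k)^{ε₀/4}`
  have h1 : ((1600 : ℝ) * ((k : ℝ) + 3) ^ 2) ^ (ε₀ / 8) =
      (1600 : ℝ) ^ (ε₀ / 8) * ((k : ℝ) + 3) ^ (ε₀ / 4) := by
    rw [Real.mul_rpow (by norm_num) (by positivity)]
    congr 1
    rw [← Real.rpow_natCast, ← Real.rpow_mul (by positivity)]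
    norm_num; ring_nf
  have h2 : ((k : ℝ) + 3) ^ (ε₀ / 4) ≤ (2 : ℝ) ^ (ε₀ / 4) * (k : ℝ) ^ (ε₀ / 4) := by
    rw [← Real.mul_rpow (by norm_num) hk0.le]
    exact Real.rpow_le_rpow (by positivity) (by linarith) (by positivity)
  have h3 : (k : ℝ) ^ ε₀ = (k : ℝ) ^ (ε₀ / 4) * (k : ℝ) ^ (3 * ε₀ / 4) := by
    rw [← Real.rpow_add hk0]; ring_nf
  rw [h1, h3]
  have hk4 : 0 ≤ (k : ℝ) ^ (ε₀ / 4) := Real.rpow_nonneg hk0.le _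
  calc 4 * ((1600 : ℝ) ^ (ε₀ / 8) * ((k : ℝ) + 3) ^ (ε₀ / 4))
      ≤ 4 * ((1600 : ℝ) ^ (ε₀ / 8) * ((2 : ℝ) ^ (ε₀ / 4) * (k : ℝ) ^ (ε₀ / 4))) := by
        gcongr
    _ = (k : ℝ) ^ (ε₀ / 4) * A := by rw [hA]; ring
    _ ≤ (k : ℝ) ^ (ε₀ / 4) * (k : ℝ) ^ (3 * ε₀ / 4) := mul_le_mul_of_nonneg_left hk hk4

/-- Eventually in `k`: the expansion scale `(1600 nRows k)^{1-δ}` is below the sparsity radius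
`⌊nRows k / C₈⌋`. [folklore] -/
theorem eventually_scale_le_radius {δ : ℝ} (hδ : 0 < δ) (hδ1 : δ < 1) :
    ∀ᶠ k : ℕ in atTop, ((1600 : ℝ) * nRows k) ^ (1 - δ) ≤ ((nRows k / liftConst : ℕ) : ℝ) := by
  set Cr : ℝ := (liftConst : ℝ) with hCr
  have hCr0 : (0 : ℝ) < Cr := by
    rw [hCr]; exact_mod_cast (show 0 < liftConst by norm_num [liftConst])
  have hT : Tendsto (fun k : ℕ => ((nRows k : ℕ) : ℝ) ^ δ) atTop atTop := by
    have h1 : Tendsto (fun k : ℕ => ((nRows k : ℕ) : ℝ)) atTop atTop := by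
      refine tendsto_natCast_atTop_atTop.comp (tendsto_atTop_mono (fun k => ?_) tendsto_id)
      have := (nRows_bounds k).2.2.2.2
      simp only [id]; nlinarith
    exact (tendsto_rpow_atTop hδ).comp h1
  filter_upwards [hT.eventually_ge_atTop (Cr * ((1600 : ℝ) ^ (1 - δ) + 2))] with k hk
  set M : ℝ := ((nRows k : ℕ) : ℝ) with hM
  have hM1 : (1 : ℝ) ≤ M := by rw [hM]; exact_mod_cast (nRows_bounds k).2.2.2.1
  have hM0 : (0 : ℝ) < M := by linarith
  have h1δ : 0 ≤ 1 - δ := by linarith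
  -- `⌊M / C₈⌋ > M / C₈ - 1`
  have hfloor : M / Cr - 1 < ((nRows k / liftConst : ℕ) : ℝ) := by
    have e : (nRows k / liftConst : ℕ) = ⌊M / Cr⌋₊ := by
      rw [hM, hCr, Nat.floor_div_natCast, Nat.floor_natCast]
    rw [e]
    have := Nat.lt_floor_add_one (M / Cr)
    linarith
  -- `(1600 M)^{1-δ} = 1600^{1-δ} M^{1-δ}` and `M = M^{1-δ} M^δ`
  have hsplit : M = M ^ (1 - δ) * M ^ δ := by
    rw [← Real.rpow_add hM0]; ring_nf; exact (Real.rpow_one M).symm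
  have hM1δ : 1 ≤ M ^ (1 - δ) := Real.one_le_rpow hM1 h1δ
  have hpow0 : 0 ≤ M ^ (1 - δ) := by linarith
  rw [Real.mul_rpow (by norm_num) hM0.le]
  have hkey : (1600 : ℝ) ^ (1 - δ) * M ^ (1 - δ) + 1 ≤ M / Cr - 1 := by
    rw [le_sub_iff_add_le, le_div_iff₀ hCr0]
    have : M ^ (1 - δ) * (Cr * ((1600 : ℝ) ^ (1 - δ) + 2)) ≤ M ^ (1 - δ) * M ^ δ :=
      mul_le_mul_of_nonneg_left hk hpow0
    rw [← hsplit] at this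
    nlinarith
  linarith

/-- The closing arithmetic of the lower bound: if a depth-`d` refutation of size `S` of the
overlaid system yields a grid refutation of size `S' ≤ T (S + 224 M + 3)³ ` and `S' ≥ 2^{k^ε₀}`,
then `S ≥ 2^{n^{ε₀/8}}` once `227 n ≤ 2^{n^{ε₀/8}}`, `8 T ≤ 2^{n^{ε₀/8}}` and
`4 (1600 (k+3)²)^{ε₀/8} ≤ k^{ε₀}` (with `M ≤ n ≤ 1600 (k+3)²`). [folklore] -/
theorem lowerBound_arith {ε₀ : ℝ} {k n M S S' T : ℕ} (hε₀ : 0 < ε₀) (hT : 0 < T)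
    (hlb : (2 : ℝ) ^ ((k : ℝ) ^ ε₀) ≤ S') (hsz : S' ≤ T * (S + 224 * M + 3) ^ 3)
    (hMn : M ≤ n) (hM1 : 1 ≤ M) (hn : n ≤ 1600 * (k + 3) ^ 2)
    (h227 : 227 * (n : ℝ) ≤ (2 : ℝ) ^ ((n : ℝ) ^ (ε₀ / 8)))
    (h8 : (8 * T : ℝ) ≤ (2 : ℝ) ^ ((n : ℝ) ^ (ε₀ / 8)))
    (hscale : 4 * ((1600 : ℝ) * ((k : ℝ) + 3) ^ 2) ^ (ε₀ / 8) ≤ (k : ℝ) ^ ε₀) :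
    (2 : ℝ) ^ ((n : ℝ) ^ (ε₀ / 8)) ≤ S := by
  by_contra hlt
  push Not at hlt
  set X : ℝ := (2 : ℝ) ^ ((n : ℝ) ^ (ε₀ / 8)) with hX
  have hX0 : 0 < X := by positivity
  have hMn' : (M : ℝ) ≤ n := by exact_mod_cast hMn
  have hM1' : (1 : ℝ) ≤ M := by exact_mod_cast hM1
  have h1 : ((S + 224 * M + 3 : ℕ) : ℝ) < 2 * X := by push_cast; nlinarith
  have h2 : (S' : ℝ) < X ^ 4 :=
    calc (S' : ℝ) ≤ T * ((S + 224 * M + 3 : ℕ) : ℝ) ^ 3 := by exact_mod_cast hsz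
      _ < T * (2 * X) ^ 3 := by
          have hT' : (0 : ℝ) < T := by exact_mod_cast hT
          exact mul_lt_mul_of_pos_left (pow_lt_pow_left₀ h1 (by positivity) (by norm_num)) hT'
      _ = (8 * T) * X ^ 3 := by ring
      _ ≤ X * X ^ 3 := mul_le_mul_of_nonneg_right h8 (by positivity)
      _ = X ^ 4 := by ring
  have h3 : (2 : ℝ) ^ ((k : ℝ) ^ ε₀) < (2 : ℝ) ^ (4 * (n : ℝ) ^ (ε₀ / 8)) := by
    calc (2 : ℝ) ^ ((k : ℝ) ^ ε₀) ≤ (S' : ℝ) := hlb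
      _ < X ^ 4 := h2
      _ = (2 : ℝ) ^ (4 * (n : ℝ) ^ (ε₀ / 8)) := by
          rw [hX, ← Real.rpow_natCast, ← Real.rpow_mul (by norm_num), mul_comm]
          norm_num
  have h4 : (k : ℝ) ^ ε₀ < 4 * (n : ℝ) ^ (ε₀ / 8) := (Real.rpow_lt_rpow_left_iff one_lt_two).1 h3
  have hn' : (n : ℝ) ≤ (1600 : ℝ) * ((k : ℝ) + 3) ^ 2 := by exact_mod_cast hn
  have hε : 0 ≤ ε₀ / 8 := by positivity
  have h5 : (n : ℝ) ^ (ε₀ / 8) ≤ ((1600 : ℝ) * ((k : ℝ) + 3) ^ 2) ^ (ε₀ / 8) :=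
    Real.rpow_le_rpow (Nat.cast_nonneg _) hn' hε
  linarith

/-! ### The family -/

/-- **The crux `LinearGeneratorDepthFregeHard` holds on the grid routing family.** For every depth
`d` and every `0 < δ < 1` there are `ε > 0` and `K₀` such that for every `k ≥ K₀` there are `n ≥ k`,
`m` and a system `E : Fin m → LinEqMod 2 n` which is `60`-sparse, whose row supports form an
`(n^(1-δ), 3/4 · 60)`-boundary expander, which is unsolvable, and every depth-`d` `textbookFrege`
proof of `¬ ofCNF (sumEncoding 1 E)` has `proofSize ≥ 2^(n^ε)`.
[Krajíček 2019, Problem 19.4.5 (this family); Urquhart–Fu 1996; Ben-Sasson 2002] [folklore] -/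
theorem linearGeneratorDepthFregeHard_on_gridFamily (d : ℕ) {δ : ℝ} (hδ : 0 < δ) (hδ1 : δ < 1) :
    ∃ ε : ℝ, 0 < ε ∧ ∃ K₀ : ℕ, ∀ k ≥ K₀, ∃ (n m : ℕ) (E : Fin m → LinEqMod 2 n), k ≤ n ∧
      (∀ i, (E i).supp.card ≤ 60) ∧
      IsBoundaryExpander (fun i => (E i).supp.map Fin.valEmbedding) ((n : ℝ) ^ (1 - δ))
        (3 / 4 * (60 : ℕ)) ∧
      ¬ SystemSat E Finset.univ ∧
      ∀ π : List (PropForm ℕ), textbookFrege.IsDepthProofOf d π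
          (neg (PropForm.ofCNF (sumEncoding 1 E))) → (2 : ℝ) ^ ((n : ℝ) ^ ε) ≤ (proofSize π : ℝ) := by
  classical
  obtain ⟨ε₀, hε₀, K₁, hK₁⟩ := gridTseitin_depthFrege_lowerBound (d + 16)
  have hε : 0 < ε₀ / 8 := by positivity
  obtain ⟨N₄, hN₄⟩ := eventually_atTop.1 (eventually_linear_le_two_rpow transferConst hε)
  obtain ⟨K₀, hK₀⟩ := eventually_atTop.1 ((eventually_ge_atTop (max K₁ N₄)).and
    ((eventually_scale_exponent hε₀).and (eventually_scale_le_radius hδ hδ1)))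
  refine ⟨ε₀ / 8, hε, K₀, fun k hk => ?_⟩
  obtain ⟨hk₁, hk₂, hk₃⟩ := hK₀ k hk
  have hK₁k : K₁ ≤ k := le_of_max_le_left hk₁
  have hN₄k : N₄ ≤ k := le_of_max_le_right hk₁
  obtain ⟨hMk, hkV, hV2, hM1, -⟩ := nRows_bounds k
  -- the graph: a `56`-regular `(nRows k / C₈, 1/8)`-sparse lift of `K₅₇`
  obtain ⟨πl, hπl⟩ := exists_sparse_lift (B := (⊤ : SimpleGraph (Fin 57))) (a := nRows k) (q := 8)
    (by norm_num) (by simp) hM1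
  have hsp : IsSparse (liftGraph πl) (nRows k / liftConst) (1 / 8) := by
    convert hπl using 2 <;> norm_num [Fintype.card_fin]
  have hreg : (liftGraph πl).IsRegularOfDegree 56 := by
    have h := isRegularOfDegree_liftGraph (B := (⊤ : SimpleGraph (Fin 57)))
      SimpleGraph.IsRegularOfDegree.top πl
    simpa only [Fintype.card_fin] using h
  set G := liftGraph πl with hG
  have hE : G.edgeFinset.card = 1596 * nRows k := by
    have h := G.sum_degrees_eq_twice_card_edges
    rw [Finset.sum_congr rfl fun v _ => hreg.degree_eq v, Finset.sum_const, smul_eq_mul,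
      Finset.card_univ, Fintype.card_prod, Fintype.card_fin, Fintype.card_fin] at h
    omega
  -- the instance
  have hn : OVars k 57 G ≤ 1600 * nRows k := by
    show nVars k + G.edgeFinset.card ≤ 1600 * nRows k
    omega
  have hMn : nRows k ≤ OVars k 57 G := by
    show nRows k ≤ nVars k + G.edgeFinset.card
    omega
  have hkn : k ≤ OVars k 57 G := hkV.trans (Nat.le_add_right _ _)
  refine ⟨OVars k 57 G, ORows k 57, overlaySystem k 57 G, hkn, ?_, ?_,
    not_systemSat_overlaySystem (by norm_num), ?_⟩
  · -- supports `≤ 4 + 56`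
    intro i
    have h := card_supp_overlay_le (G := G) ((orowEquiv k 57).symm i)
    rw [Equiv.apply_symm_apply, hreg.degree_eq] at h
    exact h
  · -- expansion at scale `n^(1-δ) ≤ (1600 nRows k)^(1-δ) ≤ ⌊nRows k / C₈⌋`
    have hr : ((OVars k 57 G : ℕ) : ℝ) ^ (1 - δ) ≤ ((nRows k / liftConst : ℕ) : ℝ) := by
      refine le_trans (Real.rpow_le_rpow (Nat.cast_nonneg _) ?_ (by linarith)) hk₃
      exact_mod_cast hn
    exact isBoundaryExpander_overlaySystem (by norm_num) hreg (by norm_num) hsp hr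
  · -- the lower bound
    intro π hπ
    obtain ⟨π', hπ', hsize⟩ := exists_grid_proof_of_overlay_proof hπ
    have hlb := hK₁ k hK₁k π' hπ'
    have hsz := hsize.trans (transferBound_le (proofSize π) (nRows k))
    obtain ⟨h227, h8⟩ := hN₄ (OVars k 57 G) (hN₄k.trans hkn)
    exact lowerBound_arith hε₀ (by unfold transferConst; omega) hlb hsz hMn hM1
      (hn.trans (Nat.mul_le_mul_left 1600 hMk))
      h227 h8 hk₂

end Summit.PneNP.PneNP.Theorems.GridRouting
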